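import Summits.QuantumFields.BalabanUV.T4Continuum.Support.NE7LawLevelAbsorptionL1
import Summits.QuantumFields.BalabanUV.T4Continuum.Support.NE7LawLevelOldLayersL1

/-!
# NE7, ROAD P4 (law-level ∕ second-moment lineage), NODE Q.old: THE AGE ASSEMBLY
# («fibre and births» per age ⊢ `PureAverageL1Rate` ∕ `OldResamplingSmall` with a SUMMABLE rate ⊢ `HasContinuumLimit`)

(Cell `pub-balaban`, sub-cell `t4`, binder row NE7 = node U5, co-owner #4 `b2b-balaban-t4-ne7-p4`, gen 6; companion
records `HOME/t4/skeletons/NE7-t4-ne7-p4.md` v1.12 and `HOME/t4/b2b-balaban-t4-ne7-p4/g5/BOOKING-H-NE7-P4.md` §2∕§5.)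

HONEST FRAMING (T4-DAG PAGE 1).  Rung (B)+1 on ONE FIXED finite four-torus, CONDITIONAL on `BetaPertH` and the nine
spine estimates (0/9 proved); NOT infinite volume, NOT a mass gap, NOT the Clay problem.  NE7 is NOT PRINTED and NOT
proved here.  Everything in this file is [folklore] measure theory ∕ real analysis over PLAIN DATA: no object of the
audited series (B12–B16) occurs, no statement of it is asserted, `BetaPertH` ∕ (B) ∕ (B^μ) enter no declaration.
NOT summit progress.

THE POINT OF THIS FILE.  The road's NODE Q.old («the resamplings OLDER than the window are invisible to unit-scale
observables, in ONE run») was typed to the bottom in three stages: the reverse-filtration second moment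
(`NE7LawLevelOldLayers(L1)`: `OldLayerDatumL1 ⊢ ∫|F − Φp| ≤ total`, `total ≤ rem + c·q^{n₀}/(1 − q)`), the LABELLED
filtration (`NE7LawLevelLabelled`) and ABSORPTION (`NE7LawLevelPredictor`, `NE7LawLevelAbsorption(L1)`: the layer sum of
one age is bounded by the structured predictor's one-step conditional fluctuations — the FIBRE entries — plus the
initial residual and the DEFECTS born at the label's events — the BIRTH entries — in the ℓ¹-in-births form
`absorption_minkowski`).  This file COMPOSES them, per age and across the runs `K`, and adds the window arithmetic:
* §1 `AgeDatum P F Φp` — per `K`: for every old age `n` a labelled reverse filtration, the first-order summand `S n`,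
  an ADAPTED bounded predictor `A n`, and NUMERIC budgets for (noise, fibre = Σ_j ∫cfluct², initial residual, births =
  defects, unit-layer mean); its `bracket n := vNoise + (2·vFib + 2·(bRes + Σ_m bDef)²) + vMean`;
  `AgeDatum.toL1` (an `OldLayerDatumL1` whose layer budgets are the increments' integrals verbatim) and
  `AgeDatum.bracket_toL1_le` (by `absorption_minkowski`), hence `integral_abs_sub_le_of_ageDatum`
  (`∫|F − Φp| ≤ rem + Σ_{n∈ages} √bracket n`) and `AgeDatum.integral_abs_sub_le_of_geometric`
  (ages `≥ n₀`, `bracket n ≤ (c qⁿ)²` ⇒ `≤ rem + c·q^{n₀}/(1 − q)`).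
* §2 the WINDOW ARITHMETIC: `pow_window_le_rpow` (`q^{n₀} ≤ K^{−a·log q⁻¹}` when `a·log K ≤ n₀`, `K ≥ 1`) and
  `summable_pow_window` (`1 < a·log q⁻¹` ⇒ `Σ_K q^{n₀ K} < ∞`) — the skeleton's «s_K ≍ K^{−a log(1∕q)}, summable for
  a·log(1∕q) > 1».
* §3 across `K`: the shape `AgeBudget Ω P F Φp r n₀ q` and `pureAverageL1Rate_of_ageBudget`
  (⊢ `PureAverageL1Rate Ω P F Φp (fun K ↦ r K + q ^ n₀ K)`), `summable_window_rate`, and the END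
  `lawLevel_cauchy_of_fibre_and_births`: dressing means + the split `m = w + dold + drec` + an `AgeBudget` realised on
  the runs' chains (mean factors through the endpoints) + the recent-resampling rate + the TV rate, all rates summable
  ⊢ `Missing.HasContinuumLimit S` — through `oldResamplingSmall_of_pureAverageL1Rate`, `dressingMeanRate_of_split` and
  `hasContinuumLimit_of_dressingMeans` BY NAME.
WHAT THIS FILE DOES NOT DO: it proves no budget.  The numbers `vFib`, `bRes`, `bDef`, `vMean`, `vNoise`, `rem` are the
road's per-age inputs ((QV)+(QL) profile for the fibre entries, LEMMA PO ∕ the pre-R window inequality ∕ the post-R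
B′-form for the births, (QM) for the unit-layer mean, (QI) for the noise, (QT) for the remainder — BOOKING-H §5), none
of them printed or proved; the geometric profile `bracket n ≤ (c qⁿ)²` with `q = L^{−(γ−1)}` is BOOKING-H §5's COUNT,
a paper-level derivation under the readings (R-class)(R-crude)(R-R).  NE7's two-run content is untouched.
-/

noncomputable section

open MeasureTheory Finset Filter
open scoped BigOperators

namespace Summit.QuantumFields.BalabanUV.T4Continuum.NE7LawLevel

open Literature.MathematicalPhysics.QuantumFieldTheory.Balaban1983to89
open Literature.MathematicalPhysics.QuantumFieldTheory.Balaban1983to89.T4MeanChannel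
open Missing

/-! ## §1 One run, one `K`: the AGE DATUM («fibre and births» budgets per age) and its L¹ conclusion -/

section Datum

variable {Ω : Type*} [MeasurableSpace Ω]

/-- **AGE DATUM (one run, one `K`; hypothesis SHAPE over plain data).**  For every old age `n ∈ ages`: a labelled reverse
filtration `𝓕 n` (antitone, below the ambient σ-algebra), the bounded measurable first-order summand `S n`, an ADAPTED
bounded structured predictor `A n j` of `P[S n | 𝓕 n j]` (`A n j` is `𝓕 n j`-measurable), a depth, and NUMERIC budgets:
`vNoise` (resampling noise), `vFib` (the FIBRE entries: the sum over the layers `j < depth n` of the predictor's one-step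
conditional fluctuations `∫ (A n j − P[A n j | 𝓕 n (j+1)])²`), `bRes` (square root of the initial residual's second
moment), `bDef n m` (the BIRTH entries: square roots of the second moments of the defects
`P[A n m | 𝓕 n (m+1)] − A n (m+1)` born at layer `m+1`), `vMean` (squared unit-layer conditional mean), and the L¹
Taylor remainder `rem`.  Nothing here is a Bałaban object; the dictionary is BOOKING-H §1–§2. [folklore] -/
structure AgeDatum (P : Measure Ω) (F Φp : Ω → ℝ) where
  /-- the old ages present at this level -/
  ages : Finset ℕ
  /-- first-order summand of age `n` -/
  S : ℕ → Ω → ℝ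
  /-- labelled reverse filtration for age `n` -/
  𝓕 : ℕ → ℕ → MeasurableSpace Ω
  /-- number of layers used for age `n` -/
  depth : ℕ → ℕ
  /-- structured predictor of age `n` at layer `j` -/
  A : ℕ → ℕ → Ω → ℝ
  /-- a pointwise bound of `S n` -/
  bound : ℕ → ℝ
  /-- a pointwise bound of the predictor `A n ·` -/
  boundA : ℕ → ℝ
  /-- L¹ Taylor remainder budget -/
  rem : ℝ
  /-- resampling-noise variance budget of age `n` -/
  vNoise : ℕ → ℝ
  /-- FIBRE budget of age `n`: the layer sum of the predictor's one-step conditional fluctuations -/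
  vFib : ℕ → ℝ
  /-- initial-residual budget of age `n` (a square root of a second moment) -/
  bRes : ℕ → ℝ
  /-- BIRTH budget of age `n`, defect born at layer `m+1` (a square root of a second moment) -/
  bDef : ℕ → ℕ → ℝ
  /-- squared conditional-mean budget of age `n` at depth `depth n` -/
  vMean : ℕ → ℝ
  S_meas : ∀ n, Measurable (S n)
  S_bdd : ∀ n ω, |S n ω| ≤ bound n
  𝓕_le : ∀ n j, 𝓕 n j ≤ ‹MeasurableSpace Ω›
  𝓕_anti : ∀ n, Antitone (𝓕 n)
  A_meas : ∀ n j, StronglyMeasurable[𝓕 n j] (A n j)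
  A_bdd : ∀ n j ω, |A n j ω| ≤ boundA n
  taylorL1 : ∫ ω, |F ω - Φp ω - ∑ n ∈ ages, S n ω| ∂P ≤ rem
  noise : ∀ n ∈ ages, ∫ ω, (S n ω - P[S n|𝓕 n 0] ω) ^ 2 ∂P ≤ vNoise n
  fibre : ∀ n ∈ ages,
    ∑ j ∈ range (depth n), ∫ ω, (A n j - P[A n j|𝓕 n (j + 1)]) ω ^ 2 ∂P ≤ vFib n
  resid : ∀ n ∈ ages, Real.sqrt (∫ ω, (P[S n|𝓕 n 0] - A n 0) ω ^ 2 ∂P) ≤ bRes n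
  births : ∀ n ∈ ages, ∀ m < depth n,
    Real.sqrt (∫ ω, (P[A n m|𝓕 n (m + 1)] - A n (m + 1)) ω ^ 2 ∂P) ≤ bDef n m
  mean : ∀ n ∈ ages, ∫ ω, (P[S n|𝓕 n (depth n)]) ω ^ 2 ∂P ≤ vMean n

variable {P : Measure Ω} {F Φp : Ω → ℝ}

/-- The age-`n` bracket of an age datum: `vNoise + (2·vFib + 2·(bRes + Σ_{m<depth} bDef)²) + vMean`. -/
def AgeDatum.bracket (D : AgeDatum P F Φp) (n : ℕ) : ℝ :=
  D.vNoise n + (2 * D.vFib n + 2 * (D.bRes n + ∑ m ∈ range (D.depth n), D.bDef n m) ^ 2) + D.vMean n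

/-- An age datum IS an old-layer datum whose layer budgets are the increments' second moments verbatim. [folklore] -/
def AgeDatum.toL1 (D : AgeDatum P F Φp) : OldLayerDatumL1 P F Φp where
  ages := D.ages
  S := D.S
  𝓕 := D.𝓕
  depth := D.depth
  bound := D.bound
  rem := D.rem
  vNoise := D.vNoise
  vLayer := fun n j => ∫ ω, incr P (D.𝓕 n) (D.S n) j ω ^ 2 ∂P
  mMean := D.vMean
  S_meas := D.S_meas
  S_bdd := D.S_bdd
  𝓕_le := D.𝓕_le
  𝓕_anti := D.𝓕_anti
  taylorL1 := D.taylorL1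
  noise := D.noise
  layer := fun _ _ _ _ => le_rfl
  mean := D.mean

/-- **ABSORPTION INSIDE THE BRACKET:** for `n ∈ ages`, the old-layer bracket of `D.toL1` is at most the age datum's
bracket — the layer sum is absorbed into FIBRE + BIRTH budgets by `absorption_minkowski` (ℓ¹ in births, no depth
factor). [folklore] -/
theorem AgeDatum.bracket_toL1_le [IsFiniteMeasure P] (D : AgeDatum P F Φp) {n : ℕ} (hn : n ∈ D.ages) :
    D.toL1.bracket n ≤ D.bracket n := by
  unfold OldLayerDatumL1.bracket AgeDatum.bracket
  simp only [AgeDatum.toL1]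
  refine add_le_add (add_le_add le_rfl ?_) le_rfl
  have habs := absorption_minkowski (μ := P) (D.𝓕_anti n) (D.𝓕_le n) (D.S_bdd n) (D.A_meas n) (D.A_bdd n)
    (D.depth n)
  refine habs.trans ?_
  have h1 : 2 * ∑ j ∈ range (D.depth n), ∫ ω, (D.A n j - P[D.A n j|D.𝓕 n (j + 1)]) ω ^ 2 ∂P ≤ 2 * D.vFib n :=
    mul_le_mul_of_nonneg_left (D.fibre n hn) (by norm_num)
  have hsum_nonneg : 0 ≤ Real.sqrt (∫ ω, (P[D.S n|D.𝓕 n 0] - D.A n 0) ω ^ 2 ∂P) +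
      ∑ m ∈ range (D.depth n), Real.sqrt (∫ ω, (P[D.A n m|D.𝓕 n (m + 1)] - D.A n (m + 1)) ω ^ 2 ∂P) :=
    add_nonneg (Real.sqrt_nonneg _) (sum_nonneg fun _ _ => Real.sqrt_nonneg _)
  have h2 : Real.sqrt (∫ ω, (P[D.S n|D.𝓕 n 0] - D.A n 0) ω ^ 2 ∂P) +
      ∑ m ∈ range (D.depth n), Real.sqrt (∫ ω, (P[D.A n m|D.𝓕 n (m + 1)] - D.A n (m + 1)) ω ^ 2 ∂P) ≤
      D.bRes n + ∑ m ∈ range (D.depth n), D.bDef n m :=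
    add_le_add (D.resid n hn) (sum_le_sum fun m hm => D.births n hn m (mem_range.mp hm))
  have h3 : (Real.sqrt (∫ ω, (P[D.S n|D.𝓕 n 0] - D.A n 0) ω ^ 2 ∂P) +
      ∑ m ∈ range (D.depth n), Real.sqrt (∫ ω, (P[D.A n m|D.𝓕 n (m + 1)] - D.A n (m + 1)) ω ^ 2 ∂P)) ^ 2 ≤
      (D.bRes n + ∑ m ∈ range (D.depth n), D.bDef n m) ^ 2 :=
    pow_le_pow_left₀ hsum_nonneg h2 2
  linarith

/-- The total of `D.toL1` is at most `rem + Σ_{n∈ages} √(bracket n)`. [folklore] -/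
theorem AgeDatum.total_toL1_le [IsFiniteMeasure P] (D : AgeDatum P F Φp) :
    D.toL1.total ≤ D.rem + ∑ n ∈ D.ages, Real.sqrt (D.bracket n) := by
  unfold OldLayerDatumL1.total
  exact add_le_add le_rfl (sum_le_sum fun n hn => Real.sqrt_le_sqrt (D.bracket_toL1_le hn))

/-- **NODE Q.old FROM FIBRE AND BIRTHS (one run, one `K`):** `∫ |F − Φp| dP ≤ rem + Σ_{n∈ages} √(bracket n)`.
[folklore] -/
theorem integral_abs_sub_le_of_ageDatum [IsProbabilityMeasure P] (hFm : Measurable F) (hΦm : Measurable Φp)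
    (hFb : ∀ ω, |F ω| ≤ 1) (hΦb : ∀ ω, |Φp ω| ≤ 1) (D : AgeDatum P F Φp) :
    ∫ ω, |F ω - Φp ω| ∂P ≤ D.rem + ∑ n ∈ D.ages, Real.sqrt (D.bracket n) :=
  (integral_abs_sub_le_totalL1 hFm hΦm hFb hΦb D.toL1).trans D.total_toL1_le

/-- **THE WINDOW FORM:** ages `≥ n₀` and a geometric age profile `bracket n ≤ (c qⁿ)²` give
`∫ |F − Φp| dP ≤ rem + c·q^{n₀}/(1 − q)`. [folklore] -/
theorem AgeDatum.integral_abs_sub_le_of_geometric [IsProbabilityMeasure P] (hFm : Measurable F)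
    (hΦm : Measurable Φp) (hFb : ∀ ω, |F ω| ≤ 1) (hΦb : ∀ ω, |Φp ω| ≤ 1) (D : AgeDatum P F Φp) {n₀ : ℕ}
    {c q : ℝ} (hc : 0 ≤ c) (hq0 : 0 ≤ q) (hq1 : q < 1) (hages : ∀ n ∈ D.ages, n₀ ≤ n)
    (hbr : ∀ n ∈ D.ages, D.bracket n ≤ (c * q ^ n) ^ 2) :
    ∫ ω, |F ω - Φp ω| ∂P ≤ D.rem + c * q ^ n₀ / (1 - q) := by
  refine (integral_abs_sub_le_totalL1 hFm hΦm hFb hΦb D.toL1).trans ?_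
  exact D.toL1.total_le_of_geometric hc hq0 hq1 hages fun n hn => (D.bracket_toL1_le hn).trans (hbr n hn)

end Datum

/-! ## §2 The window arithmetic: `n₀(K) ≥ a·log K` and `a·log(1∕q) > 1` make `K ↦ q^{n₀(K)}` summable -/

section Window

/-- For `0 < q ≤ 1`, `1 ≤ K` and `a·log K ≤ n₀`: `q^{n₀} ≤ K^{−(a·log q⁻¹)}`. [folklore] -/
theorem pow_window_le_rpow {q a : ℝ} (hq0 : 0 < q) (hq1 : q ≤ 1) {K : ℕ} (hK : 1 ≤ K) {n₀ : ℕ}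
    (hn₀ : a * Real.log K ≤ n₀) : q ^ n₀ ≤ (K : ℝ) ^ (-(a * Real.log q⁻¹)) := by
  have hK' : (0 : ℝ) < K := by exact_mod_cast hK
  have hlogq : Real.log q ≤ 0 := Real.log_nonpos hq0.le hq1
  -- q^{n₀} = exp(n₀ log q) ≤ exp(a log K · log q) = K^{a log q} = K^{-(a log q⁻¹)}
  rw [← Real.rpow_natCast, Real.rpow_def_of_pos hq0, Real.rpow_def_of_pos hK']
  refine Real.exp_le_exp.mpr ?_
  rw [Real.log_inv]
  have : Real.log K * -(a * -Real.log q) = a * Real.log K * Real.log q := by ring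
  rw [this]
  have h := mul_le_mul_of_nonpos_right hn₀ hlogq
  linarith [h]

/-- **THE WINDOW IS SUMMABLE:** for `0 ≤ q < 1`, `1 < a·log q⁻¹` and a window `n₀` with `a·log K ≤ n₀ K` for all `K`,
`Σ_K q^{n₀ K} < ∞`. [folklore] -/
theorem summable_pow_window {q a : ℝ} (hq0 : 0 ≤ q) (hq1 : q < 1) (ha : 1 < a * Real.log q⁻¹) {n₀ : ℕ → ℕ}
    (hn₀ : ∀ K : ℕ, a * Real.log K ≤ n₀ K) : Summable fun K : ℕ => q ^ n₀ K := by
  rcases hq0.eq_or_lt with rfl | hq0'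
  · -- q = 0: then log q⁻¹ = 0, contradicting `ha`
    exfalso; simp at ha; linarith
  set p : ℝ := a * Real.log q⁻¹ with hp
  -- compare with K ↦ K^{−p} from K = 1 on
  have hcomp : Summable fun K : ℕ => ((K + 1 : ℕ) : ℝ) ^ (-p) := by
    have h := (Real.summable_nat_rpow.mpr (show -p < -1 by linarith))
    exact (summable_nat_add_iff 1).mpr h
  refine (summable_nat_add_iff 1).mp ?_
  refine Summable.of_nonneg_of_le (fun K => pow_nonneg hq0 _) (fun K => ?_) hcomp
  exact pow_window_le_rpow hq0' hq1.le (by omega) (hn₀ (K + 1))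

end Window

/-! ## §3 Across the runs: the AGE BUDGET shape, `PureAverageL1Rate` with a summable rate, and the END -/

section Across

variable {O : Type*}

/-- **AGE BUDGET (ONE-RUN hypothesis shape, NOT PRINTED):** for every string `os` there is `c ≥ 0` such that, for every
`K`, run `K`'s chain carries the bounded measurable true dressing `F K os` and pure-average dressing `Φp K os` and an
`AgeDatum` whose ages are `≥ n₀ K` (the window), whose brackets have the geometric profile `≤ (c qⁿ)²`, and whose
remainder is `≤ c·r K`.  For Bałaban's chain this is BOOKING-H §5's count (`q = L^{−(γ−1)}(1+o(1))`) — a paper-level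
derivation under the road's readings, NOT a theorem of this tree. [folklore] -/
def AgeBudget (Ω : ℕ → Type*) [∀ K, MeasurableSpace (Ω K)] (P : ∀ K, Measure (Ω K))
    (F Φp : ∀ K, List O → Ω K → ℝ) (r : ℕ → ℝ) (n₀ : ℕ → ℕ) (q : ℝ) : Prop :=
  ∀ os, ∃ c : ℝ, 0 ≤ c ∧ ∀ K, Measurable (F K os) ∧ Measurable (Φp K os) ∧ (∀ ω, |F K os ω| ≤ 1) ∧
    (∀ ω, |Φp K os ω| ≤ 1) ∧ ∃ D : AgeDatum (P K) (F K os) (Φp K os),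
      (∀ n ∈ D.ages, n₀ K ≤ n) ∧ (∀ n ∈ D.ages, D.bracket n ≤ (c * q ^ n) ^ 2) ∧ D.rem ≤ c * r K

/-- **NODE Q.old PRODUCED FROM FIBRE AND BIRTHS:** an age budget with window `n₀` and ratio `q ∈ [0,1)` gives
`PureAverageL1Rate` with the rate `K ↦ r K + q^{n₀ K}`. [folklore] -/
theorem pureAverageL1Rate_of_ageBudget {Ω : ℕ → Type*} [∀ K, MeasurableSpace (Ω K)] {P : ∀ K, Measure (Ω K)}
    [∀ K, IsProbabilityMeasure (P K)] {F Φp : ∀ K, List O → Ω K → ℝ} {r : ℕ → ℝ} {n₀ : ℕ → ℕ} {q : ℝ}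
    (hq0 : 0 ≤ q) (hq1 : q < 1) (hr : ∀ K, 0 ≤ r K) (h : AgeBudget Ω P F Φp r n₀ q) :
    PureAverageL1Rate Ω P F Φp fun K => r K + q ^ n₀ K := by
  intro os
  obtain ⟨c, hc0, hc⟩ := h os
  have h1q : 0 < 1 - q := by linarith
  refine ⟨max c (c / (1 - q)), le_max_of_le_left hc0, fun K => ?_⟩
  obtain ⟨hFm, hΦm, hFb, hΦb, D, hages, hbr, hrem⟩ := hc K
  refine ⟨hFm, hΦm, hFb, hΦb, add_nonneg (hr K) (pow_nonneg hq0 _), ?_⟩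
  have hD := D.integral_abs_sub_le_of_geometric hFm hΦm hFb hΦb hc0 hq0 hq1 hages hbr
  refine hD.trans ?_
  have hM1 : c ≤ max c (c / (1 - q)) := le_max_left _ _
  have hM2 : c / (1 - q) ≤ max c (c / (1 - q)) := le_max_right _ _
  have hqn : 0 ≤ q ^ n₀ K := pow_nonneg hq0 _
  have hcq : c * q ^ n₀ K / (1 - q) = c / (1 - q) * q ^ n₀ K := by ring
  calc D.rem + c * q ^ n₀ K / (1 - q) ≤ c * r K + c / (1 - q) * q ^ n₀ K := by rw [hcq]; linarith [hrem]
    _ ≤ max c (c / (1 - q)) * r K + max c (c / (1 - q)) * q ^ n₀ K :=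
        add_le_add (mul_le_mul_of_nonneg_right hM1 (hr K)) (mul_le_mul_of_nonneg_right hM2 hqn)
    _ = max c (c / (1 - q)) * (r K + q ^ n₀ K) := by ring

/-- **THE RATE IS SUMMABLE:** `Σ r < ∞`, `1 < a·log q⁻¹` and the window `a·log K ≤ n₀ K` give
`Σ_K (r K + q^{n₀ K}) < ∞`. [folklore] -/
theorem summable_window_rate {r : ℕ → ℝ} {n₀ : ℕ → ℕ} {q a : ℝ} (hq0 : 0 ≤ q) (hq1 : q < 1)
    (ha : 1 < a * Real.log q⁻¹) (hn₀ : ∀ K : ℕ, a * Real.log K ≤ n₀ K) (hr : Summable r) :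
    Summable fun K => r K + q ^ n₀ K :=
  hr.add (summable_pow_window hq0 hq1 ha hn₀)

variable {X : Type*} [MeasurableSpace X]

/-- **Q.old FROM FIBRE AND BIRTHS, realised on the chains:** if run `K`'s chain `(Ω K, P K)` has endpoint `Y K` of law
`ν K` and `dold K os` is a mean factor of `F K os − Φp K os` through `Y K` (bounded by `2`), an age budget gives
`OldResamplingSmall ν dold (fun K ↦ r K + q^{n₀ K})`. [folklore] -/
theorem oldResamplingSmall_of_ageBudget {Ω : ℕ → Type*} [∀ K, MeasurableSpace (Ω K)] (P : ∀ K, Measure (Ω K))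
    [∀ K, IsProbabilityMeasure (P K)] {Y : ∀ K, Ω K → X} (hY : ∀ K, Measurable (Y K))
    {F Φp : ∀ K, List O → Ω K → ℝ} {r : ℕ → ℝ} {n₀ : ℕ → ℕ} {q : ℝ} (hq0 : 0 ≤ q) (hq1 : q < 1)
    (hr : ∀ K, 0 ≤ r K) (h : AgeBudget Ω P F Φp r n₀ q) {ν : ℕ → Measure X} (hν : ∀ K, (P K).map (Y K) = ν K)
    {dold : ℕ → List O → X → ℝ}
    (hfac : ∀ K os, IsMeanFactor (P K) (Y K) (fun ω => F K os ω - Φp K os ω) (dold K os))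
    (hb : ∀ K os x, |dold K os x| ≤ 2) : OldResamplingSmall ν dold fun K => r K + q ^ n₀ K :=
  oldResamplingSmall_of_pureAverageL1Rate P hY (pureAverageL1Rate_of_ageBudget hq0 hq1 hr h) hν hfac hb

omit [MeasurableSpace X] in
/-- Shifting a summable sequence keeps it summable (the `s (K+1)` term of `dressingMeanRate_of_split`). -/
private theorem summable_succ {s : ℕ → ℝ} (hs : Summable s) : Summable fun K => s (K + 1) :=
  (summable_nat_add_iff 1).mpr hs

/-- **THE AGE ASSEMBLY — END (`lawLevel_cauchy_of_fibre_and_births`).**  Dressing means `m` splitting as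
`m K os = w os + dold K os + drec K os` (undressed part, old resamplings, recent resamplings); the OLD part realised on the
runs' chains as mean factors of `F − Φp` through the endpoints, with an AGE BUDGET (fibre + birth budgets per age,
geometric profile, window `n₀ K ≥ a·log K`, `1 < a·log q⁻¹`, summable remainder rate `r`); the RECENT part's two-run
rate `ϱ` and the TV rate `t` summable ⊢ `HasContinuumLimit S` — every joint expectation of the scheme converges along
the full sequence.  Composition of `oldResamplingSmall_of_ageBudget`, `summable_window_rate`,
`dressingMeanRate_of_split` and `hasContinuumLimit_of_dressingMeans`; no estimate is proved here. [folklore] -/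
theorem lawLevel_cauchy_of_fibre_and_births {G : Type*} [MeasurableSpace G] [GaugeGroup G] [HaarData G]
    (S : TorusScheme G O) {ν : ℕ → Measure X} [∀ K, IsProbabilityMeasure (ν K)]
    {m : ℕ → List O → X → ℝ} (hm : DressingMeans S ν m)
    {w : List O → X → ℝ} {dold drec : ℕ → List O → X → ℝ}
    (hsplit : ∀ K os u, m K os u = w os u + dold K os u + drec K os u)
    {Ω : ℕ → Type*} [∀ K, MeasurableSpace (Ω K)] (P : ∀ K, Measure (Ω K)) [∀ K, IsProbabilityMeasure (P K)]
    {Y : ∀ K, Ω K → X} (hY : ∀ K, Measurable (Y K)) (hν : ∀ K, (P K).map (Y K) = ν K)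
    {F Φp : ∀ K, List O → Ω K → ℝ}
    (hfac : ∀ K os, IsMeanFactor (P K) (Y K) (fun ω => F K os ω - Φp K os ω) (dold K os))
    (hb : ∀ K os x, |dold K os x| ≤ 2)
    {r : ℕ → ℝ} {n₀ : ℕ → ℕ} {q a : ℝ} (hq0 : 0 ≤ q) (hq1 : q < 1) (hr0 : ∀ K, 0 ≤ r K) (hr : Summable r)
    (ha : 1 < a * Real.log q⁻¹) (hn₀ : ∀ K : ℕ, a * Real.log K ≤ n₀ K)
    (hAge : AgeBudget Ω P F Φp r n₀ q)
    {ϱ t : ℕ → ℝ} (hrec : RecentResamplingRate ν drec ϱ) (ht : TVSeq ν t) (hϱ : Summable ϱ)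
    (hts : Summable t) : HasContinuumLimit S := by
  have hold : OldResamplingSmall ν dold fun K => r K + q ^ n₀ K :=
    oldResamplingSmall_of_ageBudget P hY hq0 hq1 hr0 hAge hν hfac hb
  have hs : Summable fun K => r K + q ^ n₀ K := summable_window_rate hq0 hq1 ha hn₀ hr
  have hq : DressingMeanRate ν m fun K => (r (K + 1) + q ^ n₀ (K + 1)) + (r K + q ^ n₀ K) + t K + ϱ K :=
    dressingMeanRate_of_split hsplit hold hrec ht
  have hqs : Summable fun K => (r (K + 1) + q ^ n₀ (K + 1)) + (r K + q ^ n₀ K) + t K + ϱ K :=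
    (((summable_succ hs).add hs).add hts).add hϱ
  exact hasContinuumLimit_of_dressingMeans S hm hq ht hqs hts

end Across

end Summit.QuantumFields.BalabanUV.T4Continuum.NE7LawLevel

end
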